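import Literature.Topology.FourManifolds.HCobordismOneLeaf
import Literature.Topology.FourManifolds.HCobordismEliminationStepsProofs
import Literature.Topology.FourManifolds.HCobordismTheoremProofs
import Literature.Topology.FourManifolds.RearrangementSlabProofs
import Literature.Topology.FourManifolds.HCobordismSlideStepSign
import Literature.Topology.FourManifolds.HCobordismIntersectionNumberSlabProofs
import Literature.Topology.FourManifolds.HCobordismWhitneyIsotopyProofs
import HarnessLib

/-!
# Discharged facts: the h-cobordism theorem (Milnor 1965, Thms. 9.1, 9.2, 7.8) and the remaining
# intermediate facts of its proof DAG hold

The directory decomposed Milnor's *Lectures on the h-cobordism theorem* (1965) into named facts and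
proved every leaf; the last leaf to land was the Basis Theorem 7.6 on a slab
(`Cobordism.Milnor1965_basisTheorem_slab_holds`, `HCobordismSlideStepSign.lean`), preceded by
Whitney's Thm. 6.6 (`Milnor1965_whitney_isotopy_holds`), Cor. 7.3 on a slab
(`Cobordism.Milnor1965_intersectionNumber_slab_holds`) and Thms. 4.1/4.2 on a slab
(`Cobordism.Milnor1965_rearrangement_slab_holds`).  The reductions of the parent facts to these
leaves are theorems of the tree whose docstrings announce "the discharge `…_holds` is this theorem
applied to the `_holds`, once they land" (`HCobordismOneLeaf.lean`, `HCobordismThreeLeaves.lean`,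
`HCobordismEliminationStepsProofs.lean`, `HCobordismTheoremProofs.lean`,
`HCobordismBasisTheorem.lean`).  This file writes those one-line discharges (no statement changed,
no definition, no new named fact, D-0026):

* `isTrivial_of_isHCobordism_of_five_le_holds` — **the h-cobordism theorem** (Milnor 1965,
  Thm. 9.1): a simply connected h-cobordism of dimension `≥ 6` between simply connected closed
  manifolds is trivial;
* `nonempty_diffeomorph_of_isHCobordant_of_five_le_holds` — **Milnor 1965, Thm. 9.2**: h-cobordant
  simply connected closed smooth manifolds of dimension `≥ 5` are diffeomorphic;
* `Milnor1965_exists_isMorseFunction_forall_not_isMCriticalPt_holds` — **Thm. 7.8** (a Morse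
  function without critical points on such an h-cobordism);
* `Cobordism.Milnor1965_cancel_pair_middle_holds` (proof of Thm. 7.8, the middle-index
  cancellation step), `Cobordism.Milnor1965_exists_isolatedPair_middle_holds`,
  `Cobordism.Milnor1965_exists_isolatedPair_of_basis_holds` (proof of Thm. 7.8, first half: an
  isolated algebraically cancelling pair from a basis adapted by Thm. 7.6).

## References

* J. Milnor, *Lectures on the h-cobordism theorem*, notes by L. Siebenmann and J. Sondow, Princeton
  (1965): Thms. 4.1–4.2 (PDF pp. 22–23), Thm. 6.6 and Remark (PDF pp. 38–39), Cor. 7.3 (PDF p. 47),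
  Thm. 7.6 (PDF pp. 49–50), Thm. 7.8 (PDF p. 53), Thms. 9.1–9.2 (PDF p. 57). [MilnorHCobordism1965]
-/

noncomputable section

namespace Literature.Topology.FourManifolds

universe u

/-- **Milnor 1965, Thm. 7.8 — the named fact `Milnor1965_exists_isMorseFunction_forall_not_isMCriticalPt`
holds** (`Milnor1965_exists_isMorseFunction_forall_not_isMCriticalPt_holds_of` applied to
`Cobordism.Milnor1965_basisTheorem_slab_holds`).
[cite: MilnorHCobordism1965, Thm. 7.8 and its proof (PDF p. 53), Thm. 7.6 (PDF pp. 49–50)] -/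
theorem Milnor1965_exists_isMorseFunction_forall_not_isMCriticalPt_holds :
    Milnor1965_exists_isMorseFunction_forall_not_isMCriticalPt.{u} :=
  Milnor1965_exists_isMorseFunction_forall_not_isMCriticalPt_holds_of
    Cobordism.Milnor1965_basisTheorem_slab_holds

/-- **The h-cobordism theorem (Milnor 1965, Thm. 9.1) — the named fact
`isTrivial_of_isHCobordism_of_five_le` holds** (`isTrivial_of_isHCobordism_of_five_le_holds_of`
applied to `Cobordism.Milnor1965_basisTheorem_slab_holds`; every other step of Milnor's §§2–9 is a
theorem of the tree). [cite: MilnorHCobordism1965, Thm. 9.1 and its proof (PDF p. 57), Thm. 7.6 (PDF pp. 49–50)] -/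
theorem isTrivial_of_isHCobordism_of_five_le_holds : isTrivial_of_isHCobordism_of_five_le.{u} :=
  isTrivial_of_isHCobordism_of_five_le_holds_of Cobordism.Milnor1965_basisTheorem_slab_holds

/-- **Milnor 1965, Thm. 9.2: h-cobordant simply connected closed smooth manifolds of dimension
`≥ 5` are diffeomorphic — the named fact `nonempty_diffeomorph_of_isHCobordant_of_five_le` holds**
(`nonempty_diffeomorph_of_isHCobordant_of_five_le_holds_of` applied to
`Cobordism.Milnor1965_basisTheorem_slab_holds`). [cite: MilnorHCobordism1965, Thm. 9.2 (PDF p. 57), Thm. 7.6 (PDF pp. 49–50)] -/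
theorem nonempty_diffeomorph_of_isHCobordant_of_five_le_holds :
    nonempty_diffeomorph_of_isHCobordant_of_five_le.{u} :=
  nonempty_diffeomorph_of_isHCobordant_of_five_le_holds_of Cobordism.Milnor1965_basisTheorem_slab_holds

/-- **Milnor 1965, proof of Thm. 7.8, middle-index cancellation — the named fact
`Cobordism.Milnor1965_cancel_pair_middle` holds** (`Cobordism.Milnor1965_cancel_pair_middle_of_three_leaves`
applied to the three `_holds`).
[cite: MilnorHCobordism1965, proof of Thm. 7.8 (PDF p. 53), with Thm. 7.6, Cor. 7.3, Thm. 6.6] -/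
theorem Cobordism.Milnor1965_cancel_pair_middle_holds : Cobordism.Milnor1965_cancel_pair_middle.{u} :=
  Cobordism.Milnor1965_cancel_pair_middle_of_three_leaves Cobordism.Milnor1965_basisTheorem_slab_holds
    Cobordism.Milnor1965_intersectionNumber_slab_holds Milnor1965_whitney_isotopy_holds

/-- **Milnor 1965, proof of Thm. 7.8, first half (an isolated algebraically cancelling pair from a
basis) — the named fact `Cobordism.Milnor1965_exists_isolatedPair_of_basis` holds**
(`Cobordism.Milnor1965_exists_isolatedPair_of_basis_of_parts'` applied to
`Cobordism.Milnor1965_basisTheorem_slab_holds` and `Cobordism.Milnor1965_rearrangement_slab_holds`).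
[cite: MilnorHCobordism1965, proof of Thm. 7.8 (PDF p. 53), with Thm. 7.6 (PDF p. 50) and Thms. 4.1, 4.2 (PDF pp. 22–23)] -/
theorem Cobordism.Milnor1965_exists_isolatedPair_of_basis_holds :
    Cobordism.Milnor1965_exists_isolatedPair_of_basis.{u} :=
  Cobordism.Milnor1965_exists_isolatedPair_of_basis_of_parts' Cobordism.Milnor1965_basisTheorem_slab_holds
    Cobordism.Milnor1965_rearrangement_slab_holds

/-- **Milnor 1965, proof of Thm. 7.8, first half, middle index — the named fact
`Cobordism.Milnor1965_exists_isolatedPair_middle` holds**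
(`Cobordism.Milnor1965_exists_isolatedPair_middle_of_basisTheorem` applied to
`Cobordism.Milnor1965_basisTheorem_slab_holds`).
[cite: MilnorHCobordism1965, proof of Thm. 7.8 (PDF p. 53), Thm. 7.6 (PDF p. 50)] -/
theorem Cobordism.Milnor1965_exists_isolatedPair_middle_holds :
    Cobordism.Milnor1965_exists_isolatedPair_middle.{u} :=
  Cobordism.Milnor1965_exists_isolatedPair_middle_of_basisTheorem Cobordism.Milnor1965_basisTheorem_slab_holds

end Literature.Topology.FourManifolds

end
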